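import Summits.CriticalPhenomena.Ising3DConformalLimit.Theorems.EnergyNotSigmaSquaredGapForcesFarMergingSandwichTailTightnessAux
import Literature.Probability.LatticeModels.BoxTwoPointTransfer
import Literature.Probability.LatticeModels.CriticalTwoPointBounds
import HarnessLib

/-!
# Tail tightness of the one-pinch duplicated avoidance: the rigorous FAR TAIL
# (line `one-cluster-depletion-sandwich` of crux `GapForcesFarMerging`, item stmt-CriticalPhenomena-4468;
# helper file 2/2 for the registered stub `stub_tailTightness`)

From the first-moment bound of the companion file (`tailTightness_firstMomentTail`:
`avoidIn n R y - avoid n y ≤ ∑_{v ∈ Λ_n ∖ Λ_R} ρ_n(y₀,y₁;v) ρ_n(y₂,y₃;v)`) and the deterministic inputs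
`G_n ≤ G^f_{β_c} ≤ C₁‖·‖⁻¹` (volume monotonicity `isingTwoPoint_box_le_twoPointFree`, infrared bound
`twoPointFree_criticalBeta_upper_holds`), `G^f_{β_c} = G⁺_{β_c} ≥ c‖·‖⁻²` (`criticalTwoPoint_bounds_holds`,
`twoPointPlus_criticalBeta_eq_twoPointFree_holds`) and `G_n(a,b) ≥ G^f(b-a)/2` eventually
(`eventually_box_twoPoint_ge`), the one-point densities of the one-pinch quadruple
`pinch K = (0, p_K, e₂, q_K)` decay like `(8C₁²/c)·4^K/‖v‖²` beyond `2^{K+1}`, and the shell sum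
`∑_{v ∈ Λ_n ∖ Λ_R} ‖v‖⁻⁴ ≤ 108/(R+1)` on `ℤ³` gives the registered helper `tailTightness_farTail`:

  `∃ C, ∀ K, ∀ᶠ n, ∀ R, avoidIn n R (pinch K) - avoid n (pinch K) ≤ C · 16^K / (R + 1)`,

i.e. the two independent duplicated clusters of the one-pinch system meet outside `Λ_{2^{4K+k}}` with
probability `≤ C 2^{-k}` (`farTail_dyadic`). This is the provable far end of the currency `TailTightness`;
the octaves between `2^{K+3}` and `2^{4K}` (where the first moment is `≳ 1`) are its open part. §7 records
the bookkeeping a consumer needs (`avoid ≤ avoidIn R`, antitonicity in `R`, `avoidIn n R = avoid n` once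
`R ≥ n`, measurability of `MeetIn`) and the reduction `tailTightness_additive_of_mid` of the ADDITIVE tail form
`δ·avoidIn n (2^{K+3}) ≤ avoid n + C·2^{-K}` to the open mid-range clumping
`δ·avoidIn n (2^{K+3}) ≤ avoidIn n (2^{5K+3})` along doubling octaves, as well as `tailTightness_of_noExit`:
the currency `TailTightness` itself follows from the tilted no-exit statement "given avoidance inside
`Λ_{2^{K+3}}`, the cluster `C_{n₁+n₂}(0)` stays inside `Λ_{2^{K+3}}` with conditional probability `≥ δ`".
Everything is proved; no definition and no named fact is introduced.

References: M. Aizenman, H. Duminil-Copin, Ann. of Math. 194 (2021) = arXiv:1912.07973, §4.2 (proof of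
Lemma 4.4), App. A Prop. A.3 [AizenmanDuminilCopinAnnals2021]; H. Duminil-Copin, Lectures on the Ising and
Potts models (2019), Thm. 4.8 [DuminilCopin2019].
-/

noncomputable section

namespace Summit.CriticalPhenomena.Ising3DConformalLimit.EnergyNotSigmaSquaredGapForcesFarMergingSandwich

namespace TailTightnessProof

open scoped symmDiff ENNReal Topology
open MeasureTheory Filter
open Literature.Probability.LatticeModels Literature.Probability.Percolation
open Summit.CriticalPhenomena.Ising3DConformalLimit.GapForcesFarMergingSandwich
open Summit.CriticalPhenomena.Ising3DConformalLimit.Cruxes.IsingEuclidUpgradeR4NonGaussian.FreeCovarianceDeltaDichotomy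
  (boxG threePointRatio)

/-! ## §4. Lattice sums on `ℤ³`: `∑_{v ∈ Λ_n ∖ Λ_R} ‖v‖⁻⁴ ≤ 108/(R+1)` -/

/-- `|∂Λ_m| ≤ 54 m²` in `ℤ³` for `m ≥ 1` (`|∂Λ_{k+1}| ≤ 6(2k+3)²`). [folklore] -/
theorem card_sphere_three_le {m : ℕ} (hm : 1 ≤ m) : ((sphere 3 m).card : ℝ) ≤ 54 * (m : ℝ) ^ 2 := by
  obtain ⟨k, rfl⟩ : ∃ k, m = k + 1 := ⟨m - 1, by omega⟩
  have h := card_sphere_succ_le (d := 3) k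
  norm_num at h
  push_cast
  have hk : (0 : ℝ) ≤ k := Nat.cast_nonneg k
  nlinarith [h, hk, sq_nonneg (k : ℝ)]

/-- **Shell summation**: `∑_{v ∈ Λ_n ∖ Λ_R} ‖v‖_∞⁻⁴ ≤ 108/(R+1)` on `ℤ³` (shells `|∂Λ_m| ≤ 54m²` and
`∑_{m > R} m⁻² ≤ 2/(R+1)`). [folklore] -/
theorem sum_sdiff_box_inv_norm_pow_four_le (n R : ℕ) :
    ∑ v ∈ box 3 n \ box 3 R, (‖v‖ ^ 4)⁻¹ ≤ 108 / ((R : ℝ) + 1) := by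
  have hmaps : ∀ v ∈ box 3 n \ box 3 R, Site.supNorm v ∈ Finset.Ioc R n := fun v hv => by
    rw [Finset.mem_sdiff, mem_box_iff_supNorm_le, mem_box_iff_supNorm_le] at hv
    exact Finset.mem_Ioc.2 ⟨not_le.1 hv.2, hv.1⟩
  rw [← Finset.sum_fiberwise_of_maps_to hmaps]
  have hshell : ∀ m ∈ Finset.Ioc R n,
      ∑ v ∈ (box 3 n \ box 3 R).filter (fun v => Site.supNorm v = m), (‖v‖ ^ 4)⁻¹ ≤
        54 * ((m : ℝ) ^ 2)⁻¹ := by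
    intro m hm
    have hm1 : 1 ≤ m := by have := (Finset.mem_Ioc.1 hm).1; omega
    have hmpos : (0 : ℝ) < m := by exact_mod_cast hm1
    calc ∑ v ∈ (box 3 n \ box 3 R).filter (fun v => Site.supNorm v = m), (‖v‖ ^ 4)⁻¹
        = ∑ v ∈ (box 3 n \ box 3 R).filter (fun v => Site.supNorm v = m), (((m : ℝ)) ^ 4)⁻¹ := by
          refine Finset.sum_congr rfl fun v hv => ?_
          rw [Site.norm_eq_supNorm, (Finset.mem_filter.1 hv).2]
      _ = (((box 3 n \ box 3 R).filter (fun v => Site.supNorm v = m)).card : ℝ) * (((m : ℝ)) ^ 4)⁻¹ := by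
          rw [Finset.sum_const, nsmul_eq_mul]
      _ ≤ ((sphere 3 m).card : ℝ) * (((m : ℝ)) ^ 4)⁻¹ := by
          gcongr
          exact fun v hv => mem_sphere.2 (Finset.mem_filter.1 hv).2
      _ ≤ 54 * (m : ℝ) ^ 2 * (((m : ℝ)) ^ 4)⁻¹ := by gcongr; exact card_sphere_three_le hm1
      _ = 54 * ((m : ℝ) ^ 2)⁻¹ := by field_simp
  have hsub : Finset.Ioc R n ⊆ Finset.Ioo R (n + 1) := fun m hm => by
    rw [Finset.mem_Ioc] at hm; rw [Finset.mem_Ioo]; omega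
  calc ∑ m ∈ Finset.Ioc R n, ∑ v ∈ (box 3 n \ box 3 R).filter (fun v => Site.supNorm v = m), (‖v‖ ^ 4)⁻¹
      ≤ ∑ m ∈ Finset.Ioc R n, 54 * ((m : ℝ) ^ 2)⁻¹ := Finset.sum_le_sum hshell
    _ ≤ ∑ m ∈ Finset.Ioo R (n + 1), 54 * ((m : ℝ) ^ 2)⁻¹ :=
        Finset.sum_le_sum_of_subset_of_nonneg hsub fun m _ _ => by positivity
    _ = 54 * ∑ m ∈ Finset.Ioo R (n + 1), ((m : ℝ) ^ 2)⁻¹ := by rw [Finset.mul_sum]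
    _ ≤ 54 * (2 / ((R : ℝ) + 1)) := by gcongr; exact sum_Ioo_inv_sq_le R (n + 1)
    _ = 108 / ((R : ℝ) + 1) := by ring

/-! ## §5. The critical two-point inputs and the decay of the one-point densities -/

/-- The two-point inputs at `β_c(3)` for the FREE state (Duminil-Copin 2019, Thm. 4.8, and
`μ⁺_{β_c} = μ^f_{β_c}` on pairs): `⟨σ₀σ_x⟩^f_{β_c} ≤ C₁‖x‖⁻¹` and `c‖x‖⁻² ≤ ⟨σ₀σ_x⟩^f_{β_c}` for
`x ≠ 0`, with `C₁ ≥ 1`, `c > 0`. [cite: DuminilCopin2019, Thm. 4.8, §4.4] -/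
theorem twoPointFree_bounds : ∃ C₁ c : ℝ, 1 ≤ C₁ ∧ 0 < c ∧ ∀ x : Site 3, x ≠ 0 →
    twoPointFree 3 βc x ≤ C₁ * ‖x‖⁻¹ ∧ c * (‖x‖ ^ 2)⁻¹ ≤ twoPointFree 3 βc x := by
  obtain ⟨C₁, hC₁⟩ := twoPointFree_criticalBeta_upper_holds (d := 3) le_rfl
  obtain ⟨c, C, hc, hcC⟩ := criticalTwoPoint_bounds_holds (d := 3) le_rfl
  refine ⟨max C₁ 1, c, le_max_right _ _, hc, fun x hx => ⟨?_, ?_⟩⟩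
  · have h := hC₁ x hx
    have he : (-(((3 : ℕ) : ℝ) - 2)) = -1 := by norm_num
    rw [he, Real.rpow_neg_one] at h
    exact h.trans (mul_le_mul_of_nonneg_right (le_max_left _ _) (inv_nonneg.2 (norm_nonneg _)))
  · have h := (hcC x hx).1
    have he : (-(((3 : ℕ) : ℝ) - 1)) = -(2 : ℝ) := by norm_num
    rw [he, Real.rpow_neg (norm_nonneg _), Real.rpow_two, criticalTwoPoint,
      twoPointPlus_criticalBeta_eq_twoPointFree_holds (d := 3) le_rfl x] at h
    exact h

/-- GKS I for the free box two-point function. [cite: FriedliVelenik2017, Theorem 3.20] -/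
theorem boxG_nonneg {n : ℕ} {u v : Site 3} (hu : u ∈ box 3 n) (hv : v ∈ box 3 n) : 0 ≤ boxG n u v :=
  isingTwoPoint_free_nonneg (fun {_ _ _ _ _} => GKSInequalities.gks_one_holds (zdGraph 3))
    (criticalBeta_nonneg 3) hu hv

/-- **Decay of the one-point density far from the sources**: if `‖a‖, ‖b‖, ‖b - a‖ ≤ t`,
`b ≠ a`, `‖v‖ ≥ 2t` and `G_n(a,b) ≥ G^f(b-a)/2`, then
`ρ_n(a,b;v) ≤ G^f(v-a) G^f(b-v)/G_n(a,b) ≤ (8C₁²/c) t²/‖v‖²` (volume monotonicity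
`G_n ≤ G^f`, `G^f ≤ C₁‖·‖⁻¹`, `G^f ≥ c‖·‖⁻²`). [cite: DuminilCopin2019, Thm. 4.8, §4.4] -/
theorem threePointRatio_le {n : ℕ} {t C₁ c : ℝ} (hC₁ : 1 ≤ C₁) (hc : 0 < c)
    (hbd : ∀ x : Site 3, x ≠ 0 → twoPointFree 3 βc x ≤ C₁ * ‖x‖⁻¹ ∧ c * (‖x‖ ^ 2)⁻¹ ≤ twoPointFree 3 βc x)
    {a b v : Site 3} (ha : a ∈ box 3 n) (hb : b ∈ box 3 n) (hv : v ∈ box 3 n) (ht : 0 < t)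
    (hat : ‖a‖ ≤ t) (hbt : ‖b‖ ≤ t) (hba : b - a ≠ 0) (hbat : ‖b - a‖ ≤ t) (hvt : 2 * t ≤ ‖v‖)
    (hlow : (1 - 1 / 2) * twoPointFree 3 βc (b - a) ≤ boxG n a b) :
    threePointRatio n a b v ≤ 8 * C₁ ^ 2 / c * t ^ 2 / ‖v‖ ^ 2 := by
  have hβ : 0 ≤ βc := criticalBeta_nonneg 3
  have hv0 : 0 < ‖v‖ := by linarith
  have hva : ‖v‖ / 2 ≤ ‖v - a‖ := by have := norm_sub_norm_le v a; linarith
  have hvb : ‖v‖ / 2 ≤ ‖b - v‖ := by have := norm_sub_norm_le v b; rw [norm_sub_rev] at this; linarith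
  have hva0 : v - a ≠ 0 := norm_pos_iff.1 (by linarith)
  have hvb0 : b - v ≠ 0 := norm_pos_iff.1 (by linarith)
  have hC₁0 : 0 ≤ C₁ := by linarith
  -- the two legs
  have hleg : ∀ {x : Site 3}, x ≠ 0 → ‖v‖ / 2 ≤ ‖x‖ → twoPointFree 3 βc x ≤ 2 * C₁ / ‖v‖ := by
    intro x hx hxv
    calc twoPointFree 3 βc x ≤ C₁ * ‖x‖⁻¹ := (hbd x hx).1
      _ ≤ C₁ * (‖v‖ / 2)⁻¹ := by gcongr
      _ = 2 * C₁ / ‖v‖ := by field_simp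
  have h1 : boxG n a v ≤ 2 * C₁ / ‖v‖ :=
    (isingTwoPoint_box_le_twoPointFree hβ ha hv).trans (hleg hva0 hva)
  have h2 : boxG n v b ≤ 2 * C₁ / ‖v‖ :=
    (isingTwoPoint_box_le_twoPointFree hβ hv hb).trans (hleg hvb0 hvb)
  -- the source pair
  have hba0 : 0 < ‖b - a‖ := norm_pos_iff.2 hba
  have h3 : c / (2 * t ^ 2) ≤ boxG n a b := by
    have hl := (hbd (b - a) hba).2
    calc c / (2 * t ^ 2) = (1 - 1 / 2) * (c * (t ^ 2)⁻¹) := by ring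
      _ ≤ (1 - 1 / 2) * (c * (‖b - a‖ ^ 2)⁻¹) := by gcongr
      _ ≤ (1 - 1 / 2) * twoPointFree 3 βc (b - a) := by gcongr
      _ ≤ boxG n a b := hlow
  have hD : 0 < c / (2 * t ^ 2) := by positivity
  have hnum : boxG n a v * boxG n v b ≤ (2 * C₁ / ‖v‖) * (2 * C₁ / ‖v‖) :=
    mul_le_mul h1 h2 (boxG_nonneg hv hb) (by positivity)
  calc threePointRatio n a b v = boxG n a v * boxG n v b / boxG n a b := rfl
    _ ≤ (2 * C₁ / ‖v‖) * (2 * C₁ / ‖v‖) / (c / (2 * t ^ 2)) :=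
        div_le_div₀ (by positivity) hnum hD h3
    _ = 8 * C₁ ^ 2 / c * t ^ 2 / ‖v‖ ^ 2 := by field_simp; ring

/-! ## §6. The one-pinch quadruple: geometry and the far tail -/

/-- Sup-norm bound from coordinates. [folklore] -/
theorem norm_le_of_natAbs_le {x : Site 3} {N : ℕ} (h : ∀ i, (x i).natAbs ≤ N) : ‖x‖ ≤ N := by
  rw [Site.norm_eq_supNorm]
  exact_mod_cast Site.supNorm_le_iff.2 h

/-- The far ends have norm `≤ 2^K`, and so have the source differences `p_K - 0`, `q_K - e₂`,
which are nonzero. [folklore] -/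
theorem pinch_geometry (K : ℕ) :
    ‖(0 : Site 3)‖ ≤ (2 : ℝ) ^ K ∧ ‖e₂‖ ≤ (2 : ℝ) ^ K ∧ ‖pFar K‖ ≤ (2 : ℝ) ^ K ∧ ‖qFar K‖ ≤ (2 : ℝ) ^ K ∧
      pFar K - 0 ≠ 0 ∧ ‖pFar K - 0‖ ≤ (2 : ℝ) ^ K ∧ qFar K - e₂ ≠ 0 ∧ ‖qFar K - e₂‖ ≤ (2 : ℝ) ^ K := by
  have h1 : 1 ≤ 2 ^ K := Nat.one_le_two_pow
  have hcast : ((2 ^ K : ℕ) : ℝ) = (2 : ℝ) ^ K := by push_cast; ring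
  have hN : ∀ x : Site 3, (∀ i, (x i).natAbs ≤ 2 ^ K) → ‖x‖ ≤ (2 : ℝ) ^ K := fun x hx => by
    rw [← hcast]; exact norm_le_of_natAbs_le hx
  refine ⟨by simp, hN _ fun i => ?_, hN _ fun i => ?_, hN _ fun i => ?_, fun h => ?_, hN _ fun i => ?_,
    fun h => ?_, hN _ fun i => ?_⟩
  · fin_cases i <;> simp [h1]
  · fin_cases i <;> simp [pFar]
  · fin_cases i <;> simp [qFar]
  · have := congrFun h 0; simp [pFar] at this
  · fin_cases i <;> simp [pFar]
  · have := congrFun h 1; simp [qFar] at this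
  · fin_cases i <;> simp [qFar, h1]

/-- **The far tail for the one-pinch quadruple, main case `R + 1 ≥ 2^{K+1}`**: eventually in `n`
(uniformly in `R`), `avoidIn n R (pinch K) - avoid n (pinch K) ≤ C·16^K/(R+1)` with `C = 108·(8C₁²/c)²`.
[cite: AizenmanDuminilCopinAnnals2021, §4.2, proof of Lemma 4.4 (first moment)] -/
theorem farTail_of_le : ∃ C : ℝ, 0 < C ∧ ∀ K : ℕ, ∀ᶠ n : ℕ in atTop, ∀ R : ℕ, 2 ^ (K + 1) ≤ R + 1 →
    avoidIn n R (pinch K) - avoid n (pinch K) ≤ C * 16 ^ K / (R + 1) := by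
  obtain ⟨C₁, c, hC₁, hc, hbd⟩ := twoPointFree_bounds
  refine ⟨(8 * C₁ ^ 2 / c) ^ 2 * 108, by positivity, fun K => ?_⟩
  have hβ : 0 ≤ βc := criticalBeta_nonneg 3
  obtain ⟨hn0, hne, hnp, hnq, hp0, hnp0, hq0, hnq0⟩ := pinch_geometry K
  have ht : (0 : ℝ) < 2 ^ K := by positivity
  filter_upwards [eventually_all.2 fun i => eventually_mem_box (pinch K i),
    eventually_box_twoPoint_ge hβ one_half_pos (0 : Site 3) (pFar K),
    eventually_box_twoPoint_ge hβ one_half_pos e₂ (qFar K)] with n hbox h01 h23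
  intro R hKR
  have hb0 : (0 : Site 3) ∈ box 3 n := hbox 0
  have hbp : pFar K ∈ box 3 n := hbox 1
  have hbe : e₂ ∈ box 3 n := hbox 2
  have hbq : qFar K ∈ box 3 n := hbox 3
  have h16 : ((2 : ℝ) ^ K) ^ 2 * ((2 : ℝ) ^ K) ^ 2 = 16 ^ K :=
    calc ((2 : ℝ) ^ K) ^ 2 * ((2 : ℝ) ^ K) ^ 2 = ((2 : ℝ) ^ K) ^ 4 := by ring
      _ = ((2 : ℝ) ^ 4) ^ K := by rw [← pow_mul, ← pow_mul, mul_comm]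
      _ = 16 ^ K := by norm_num
  have hterm : ∀ v ∈ box 3 n \ box 3 R,
      threePointRatio n 0 (pFar K) v * threePointRatio n e₂ (qFar K) v ≤
        (8 * C₁ ^ 2 / c) ^ 2 * 16 ^ K * (‖v‖ ^ 4)⁻¹ := by
    intro v hv
    have hvn : v ∈ box 3 n := (Finset.mem_sdiff.1 hv).1
    have hvR : R < Site.supNorm v :=
      not_le.1 fun h => (Finset.mem_sdiff.1 hv).2 (mem_box_iff_supNorm_le.2 h)
    have hvK : 2 * (2 : ℝ) ^ K ≤ ‖v‖ := by
      rw [Site.norm_eq_supNorm, ← pow_succ']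
      exact_mod_cast hKR.trans (Nat.succ_le_of_lt hvR)
    have hv0 : 0 < ‖v‖ := by linarith
    have hr1 := threePointRatio_le hC₁ hc hbd hb0 hbp hvn ht hn0 hnp hp0 hnp0 hvK h01
    have hr2 := threePointRatio_le hC₁ hc hbd hbe hbq hvn ht hne hnq hq0 hnq0 hvK h23
    have hnn1 : 0 ≤ threePointRatio n 0 (pFar K) v :=
      div_nonneg (mul_nonneg (boxG_nonneg hb0 hvn) (boxG_nonneg hvn hbp)) (boxG_nonneg hb0 hbp)
    have hnn2 : 0 ≤ threePointRatio n e₂ (qFar K) v :=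
      div_nonneg (mul_nonneg (boxG_nonneg hbe hvn) (boxG_nonneg hvn hbq)) (boxG_nonneg hbe hbq)
    calc threePointRatio n 0 (pFar K) v * threePointRatio n e₂ (qFar K) v
        ≤ (8 * C₁ ^ 2 / c * ((2 : ℝ) ^ K) ^ 2 / ‖v‖ ^ 2) * (8 * C₁ ^ 2 / c * ((2 : ℝ) ^ K) ^ 2 / ‖v‖ ^ 2) :=
          mul_le_mul hr1 hr2 hnn2 (by positivity)
      _ = (8 * C₁ ^ 2 / c) ^ 2 * (((2 : ℝ) ^ K) ^ 2 * ((2 : ℝ) ^ K) ^ 2) * (‖v‖ ^ 4)⁻¹ := by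
          field_simp
      _ = (8 * C₁ ^ 2 / c) ^ 2 * 16 ^ K * (‖v‖ ^ 4)⁻¹ := by rw [h16]
  calc avoidIn n R (pinch K) - avoid n (pinch K)
      ≤ ∑ v ∈ box 3 n \ box 3 R, threePointRatio n 0 (pFar K) v * threePointRatio n e₂ (qFar K) v :=
        avoidIn_sub_avoid_le hbox
    _ ≤ ∑ v ∈ box 3 n \ box 3 R, (8 * C₁ ^ 2 / c) ^ 2 * 16 ^ K * (‖v‖ ^ 4)⁻¹ := Finset.sum_le_sum hterm
    _ = (8 * C₁ ^ 2 / c) ^ 2 * 16 ^ K * ∑ v ∈ box 3 n \ box 3 R, (‖v‖ ^ 4)⁻¹ := by rw [Finset.mul_sum]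
    _ ≤ (8 * C₁ ^ 2 / c) ^ 2 * 16 ^ K * (108 / ((R : ℝ) + 1)) := by
        gcongr; exact sum_sdiff_box_inv_norm_pow_four_le n R
    _ = (8 * C₁ ^ 2 / c) ^ 2 * 108 * 16 ^ K / (R + 1) := by ring

/-- **The far tail for the one-pinch quadruple** (all `K`, eventually in `n`, uniformly in `R`; the case
`R + 1 < 2^{K+1}` is the trivial bound `avoidIn ≤ 1 ≤ C·16^K/(R+1)` once `C ≥ 2`).
[cite: AizenmanDuminilCopinAnnals2021, §4.2, proof of Lemma 4.4 (first moment)] -/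
theorem farTail : ∃ C : ℝ, ∀ K : ℕ, ∀ᶠ n : ℕ in atTop, ∀ R : ℕ,
    avoidIn n R (pinch K) - avoid n (pinch K) ≤ C * 16 ^ K / (R + 1) := by
  obtain ⟨C, hC, h⟩ := farTail_of_le
  refine ⟨max C 2, fun K => ?_⟩
  filter_upwards [h K, eventually_all.2 fun i => eventually_mem_box (pinch K i)] with n hn hbox
  intro R
  by_cases hKR : 2 ^ (K + 1) ≤ R + 1
  · exact (hn R hKR).trans (by gcongr; exact le_max_left _ _)
  · haveI := isProbabilityMeasure_fourTraceLaw hbox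
    have h1 : avoidIn n R (pinch K) ≤ 1 := measureReal_le_one
    have h2 : 0 ≤ avoid n (pinch K) := measureReal_nonneg
    have hR : (R : ℝ) + 1 ≤ 2 * 16 ^ K := by
      have hR' : (R : ℝ) + 1 ≤ 2 ^ (K + 1) := by exact_mod_cast (not_le.1 hKR).le
      have h2K : (2 : ℝ) ^ K ≤ 16 ^ K := pow_le_pow_left₀ (by norm_num) (by norm_num) K
      rw [pow_succ] at hR'
      linarith
    have h3 : (1 : ℝ) ≤ max C 2 * 16 ^ K / (R + 1) := by
      rw [le_div_iff₀ (by positivity), one_mul]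
      exact hR.trans (mul_le_mul_of_nonneg_right (le_max_right C 2) (by positivity))
    linarith

/-- **Dyadic form of the far tail**: outside `Λ_{2^{4K+k}}` the two independent duplicated clusters of
the one-pinch system meet with probability `≤ C·2^{-k}` (eventually in `n`, uniformly in `k`).
[cite: AizenmanDuminilCopinAnnals2021, §4.2, proof of Lemma 4.4 (first moment)] -/
theorem farTail_dyadic : ∃ C : ℝ, 0 ≤ C ∧ ∀ K : ℕ, ∀ᶠ n : ℕ in atTop, ∀ k : ℕ,
    avoidIn n (2 ^ (4 * K + k)) (pinch K) - avoid n (pinch K) ≤ C / 2 ^ k := by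
  obtain ⟨C, h⟩ := farTail
  refine ⟨max C 0, le_max_right _ _, fun K => ?_⟩
  filter_upwards [h K] with n hn
  intro k
  refine (hn (2 ^ (4 * K + k))).trans ?_
  have h16 : (16 : ℝ) ^ K = 2 ^ (4 * K) := by rw [pow_mul]; norm_num
  push_cast
  calc C * 16 ^ K / ((2 : ℝ) ^ (4 * K + k) + 1) ≤ max C 0 * 16 ^ K / (2 : ℝ) ^ (4 * K + k) :=
        div_le_div₀ (by positivity) (by gcongr; exact le_max_left _ _) (by positivity) (by linarith)
    _ = max C 0 / 2 ^ k := by rw [pow_add, h16]; field_simp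

/-! ## §7. Bookkeeping for the consumer: monotonicity in the radius, and the additive tail form -/

/-- `avoid ≤ avoidIn R` (`MeetIn R ⊆ Meet`). [folklore] -/
theorem avoid_le_avoidIn {n : ℕ} {y : Fin 4 → Site 3} (hy : ∀ i, y i ∈ box 3 n) (R : ℕ) :
    avoid n y ≤ avoidIn n R y := by
  haveI := isProbabilityMeasure_fourTraceLaw hy
  change (fourTraceLaw n y).real (Meet y)ᶜ ≤ (fourTraceLaw n y).real (MeetIn R y)ᶜ
  exact measureReal_mono (Set.compl_subset_compl.2 fun ω ⟨u, _, hu⟩ => ⟨u, hu⟩) (measure_ne_top _ _)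

/-- `avoidIn` is non-increasing in the radius. [folklore] -/
theorem avoidIn_anti {n : ℕ} {y : Fin 4 → Site 3} (hy : ∀ i, y i ∈ box 3 n) {R R' : ℕ} (h : R ≤ R') :
    avoidIn n R' y ≤ avoidIn n R y := by
  haveI := isProbabilityMeasure_fourTraceLaw hy
  change (fourTraceLaw n y).real (MeetIn R' y)ᶜ ≤ (fourTraceLaw n y).real (MeetIn R y)ᶜ
  exact measureReal_mono (Set.compl_subset_compl.2 fun ω ⟨u, huR, hu⟩ => ⟨u, box_mono 3 h huR, hu⟩)
    (measure_ne_top _ _)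

/-- Once `Λ_R ⊇ Λ_n`, avoidance inside `Λ_R` is total avoidance. [folklore] -/
theorem avoidIn_eq_avoid {n R : ℕ} {y : Fin 4 → Site 3} (hy : ∀ i, y i ∈ box 3 n) (h : n ≤ R) :
    avoidIn n R y = avoid n y := by
  refine le_antisymm ?_ (avoid_le_avoidIn hy R)
  have h1 := avoidIn_sub_avoid_le (R := R) hy
  rw [Finset.sdiff_eq_empty_iff_subset.2 (box_mono 3 h), Finset.sum_empty] at h1
  linarith

/-- **The additive tail from a mid-range clumping input**: if along doubling octaves the avoidance inside
`Λ_{2^{5K+3}}` is at least `δ` times the avoidance inside `Λ_{2^{K+3}}` (the OPEN mid-range part of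
`TailTightness`), then, by the far tail, `δ·avoidIn n (2^{K+3}) ≤ avoid n + C·2^{-K}` — the additive
form of tail tightness that the octave counting consumes. [folklore] -/
theorem tailTightness_additive_of_mid
    (hmid : ∀ θ : ℝ, 0 < θ → ∃ δ : ℝ, 0 < δ ∧ ∀ K : ℕ, Doubling θ K → ∀ᶠ n : ℕ in atTop,
      δ * avoidIn n (2 ^ (K + 3)) (pinch K) ≤ avoidIn n (2 ^ (5 * K + 3)) (pinch K)) :
    ∀ θ : ℝ, 0 < θ → ∃ δ C : ℝ, 0 < δ ∧ ∀ K : ℕ, Doubling θ K → ∀ᶠ n : ℕ in atTop,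
      δ * avoidIn n (2 ^ (K + 3)) (pinch K) ≤ avoid n (pinch K) + C / 2 ^ K := by
  obtain ⟨C, hC0, hC⟩ := farTail_dyadic
  intro θ hθ
  obtain ⟨δ, hδ, hK⟩ := hmid θ hθ
  refine ⟨δ, C, hδ, fun K hD => ?_⟩
  filter_upwards [hK K hD, hC K] with n h1 h2
  have h3 := h2 (K + 3)
  rw [show 4 * K + (K + 3) = 5 * K + 3 by ring] at h3
  have h5 : C / 2 ^ (K + 3) ≤ C / 2 ^ K :=
    div_le_div_of_nonneg_left hC0 (by positivity) (pow_le_pow_right₀ one_le_two (by omega))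
  linarith

/-- `MeetIn R y` is measurable (a countable union of products of connection events; `Meet y` likewise,
`OnePinchDecayProof.measurableSet_meet` in the sibling dictionary file). [folklore] -/
theorem measurableSet_meetIn (R : ℕ) (y : Fin 4 → Site 3) : MeasurableSet (MeetIn R y) := by
  have h : MeetIn R y = ⋃ u ∈ box 3 R,
      (openConn (y 0) u : Set (BondConfig (Site 3))) ×ˢ (openConn (y 2) u : Set (BondConfig (Site 3))) := by
    ext ω
    simp only [Set.mem_iUnion, Set.mem_prod, exists_prop]
    exact Iff.rfl
  rw [h]
  exact MeasurableSet.biUnion (Set.to_countable _) fun u _ =>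
    (measurableSet_openConn_holds _ _).prod (measurableSet_openConn_holds _ _)

/-- **Tail tightness from tilted no-exit of ONE cluster** (the natural one-cluster mechanism): if, given
avoidance inside `Λ_{2^{K+3}}`, the first duplicated cluster `C_{n₁+n₂}(0)` stays inside `Λ_{2^{K+3}}` with
conditional probability `≥ δ` (uniformly in doubling `K`, eventually in `n`), then `TailTightness` holds
with the same `δ`: on `{C₁ ⊆ Λ_R}`, meeting anywhere is meeting inside `Λ_R`. [folklore] -/
theorem tailTightness_of_noExit
    (h : ∀ θ : ℝ, 0 < θ → ∃ δ : ℝ, 0 < δ ∧ ∀ K : ℕ, Doubling θ K → ∀ᶠ n : ℕ in atTop,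
      δ * avoidIn n (2 ^ (K + 3)) (pinch K) ≤ (fourTraceLaw n (pinch K)).real
        ((MeetIn (2 ^ (K + 3)) (pinch K))ᶜ ∩ {ω | openCluster ω.1 0 ⊆ ↑(box 3 (2 ^ (K + 3)))})) :
    TailTightness := by
  intro θ hθ
  obtain ⟨δ, hδ, hK⟩ := h θ hθ
  refine ⟨δ, hδ, fun K hD => ?_⟩
  filter_upwards [hK K hD, eventually_all.2 fun i => eventually_mem_box (pinch K i)] with n hn hbox
  haveI := isProbabilityMeasure_fourTraceLaw hbox
  refine hn.trans (measureReal_mono (fun ω ⟨hω1, hω2⟩ hM => ?_) (measure_ne_top _ _))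
  obtain ⟨u, hu1, hu2⟩ := hM
  exact hω1 ⟨u, hω2 hu1, hu1, hu2⟩

end TailTightnessProof

open MeasureTheory Filter
open Literature.Probability.LatticeModels Literature.Probability.Percolation
open Summit.CriticalPhenomena.Ising3DConformalLimit.GapForcesFarMergingSandwich

/-- **Registered helper `tailTightness_farTail`** (the rigorous FAR TAIL of tail tightness, by first
moment): there is `C` such that for every octave `K`, eventually in the box size `n`, for all radii `R`,
`avoidIn n R (pinch K) - avoid n (pinch K) ≤ C · 16^K / (R + 1)`; in particular the two independent
duplicated clusters of the one-pinch system meet outside `Λ_{2^{4K+k}}` with probability `≤ C·2^{-k}`.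
[cite: AizenmanDuminilCopinAnnals2021, §4.2, proof of Lemma 4.4, and Appendix A, Proposition A.3] -/
theorem tailTightness_farTail : ∃ C : ℝ, ∀ K : ℕ, ∀ᶠ n : ℕ in atTop, ∀ R : ℕ, avoidIn n R (pinch K) - avoid n (pinch K) ≤ C * 16 ^ K / (R + 1) :=
  TailTightnessProof.farTail

end Summit.CriticalPhenomena.Ising3DConformalLimit.EnergyNotSigmaSquaredGapForcesFarMergingSandwich

end
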